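import Literature.NumberTheory.LFunctions.HalfIsolatedZero
import Mathlib.Analysis.Complex.Liouville
import Mathlib.Analysis.Complex.RealDeriv
import Mathlib.Analysis.Calculus.IteratedDeriv.Lemmas
import Mathlib.Analysis.SpecialFunctions.Stirling
import HarnessLib

/-!
# Half-isolated zeros (Maynard–Pratt 2024), II: Gevrey bounds for the derivatives of `w₀`

Topic `Literature/NumberTheory/LFunctions`. Everything in this file is PROVED (no definition, no
named fact). First half of the in-tree proof of the ANALYTIC part of

* J. Maynard, K. Pratt, *Half-isolated zeros and zero-density estimates*, IMRN 2024 =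
  arXiv:2206.11729, **Lemma 43** (p. 25): the derivative estimate `|w₀^{(j)}(x)| ≪ (4j²/e²)^j` for
  the dyadic partition-of-unity weight `w₀(x) = H(2x−1) − H(x−1)` of
  `Literature/NumberTheory/LFunctions/HalfIsolatedZero.lean` (`MaynardPratt.w0`, with
  `h = MaynardPratt.w0Core`, `C = MaynardPratt.w0Const`, `H = MaynardPratt.w0Step`),

on the way to discharging the named fact `MaynardPratt2024_prop16` (Proposition 16). The printed
proof quotes `sup_x |h^{(j−1)}(x)| ≤ (j−1)!(2(j−1)/e)^{j−1}` from Iwaniec's *Lectures on the Riemann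
zeta function* [Iwa2014] and Stirling's formula. We prove the Gevrey-2 bound with the constant `3`
in place of `2` by **Cauchy's estimate** for the holomorphic function `hℂ(z) = e^{−1/z} e^{−1/(1−z)}`
(which restricts to `h` on `(0,1)`) on the circle of radius `x/2` about `x ∈ (0, 1/2]` (radius
`(1−x)/2` for `x ∈ [1/2, 1)`): there `Re(1/z) ≥ 2/(3x)`, so `|hℂ| ≤ e^{−2/(3x)}`, and
`m! (2/x)ᵐ e^{−2/(3x)} ≤ m! (3m/e)ᵐ`. Any constant would do for Proposition 16 as long as the
resulting Mellin decay `e^{−c√|t|}` has `c > 1/2` (file `HalfIsolatedZeroMellin.lean`); ours gives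
`c = 2/√6 > 4/5`.

## Main results (namespace `Literature.NumberTheory.LFunctions.MaynardPratt`)

* `norm_iteratedDeriv_w0Core_le` — `|h^{(m)}(x)| ≤ m!(3m/e)ᵐ` for all `x`, `m`.
* `iteratedDeriv_succ_w0` — `w₀^{(k+1)}(x) = 2^{k+1}h^{(k)}(2x−1)/C − h^{(k)}(x−1)/C`, with the
  one-sided forms `iteratedDeriv_succ_w0_of_le_one` / `_of_one_le`, the vanishing outside `(1/2, 2)`
  and at `1/2`, `2` (`iteratedDeriv_w0_half`, `iteratedDeriv_w0_two`), and the sup bounds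
  `norm_iteratedDeriv_succ_w0_le_of_le_one` (`≤ 2^{k+1}k!(3k/e)ᵏ/C`),
  `norm_iteratedDeriv_succ_w0_le_of_one_le` (`≤ k!(3k/e)ᵏ/C`).
* `two_pow_mul_gevrey_le` — `2^{k+1}k!(3k/e)ᵏ ≤ (e³/3)(6(k+1)²/e²)^{k+1}` (Stirling,
  `factorial_le_exp_mul_sqrt_mul_pow`: `n! ≤ e√n(n/e)ⁿ`).
* Tools: `pow_mul_exp_neg_mul_le` (`yᵐe^{−ay} ≤ (m/(ae))ᵐ`), `iteratedDeriv_comp_ofReal_eq`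
  (restriction to `ℝ` commutes with iterated derivatives of holomorphic functions),
  `iteratedDeriv_ofReal_comp`.

## References

* J. Maynard, K. Pratt, IMRN 2024:19, 12978–13014 = arXiv:2206.11729, Lemma 43 and its proof,
  p. 25. (`MaynardPratt2024`)
* H. Iwaniec, *Lectures on the Riemann Zeta Function*, AMS ULS 62 (2014) (the source quoted in
  print for the bound on `h^{(j)}`; not used here).
-/

noncomputable section

open Complex Real Set Filter Metric MeasureTheory
open scoped Topology Nat

namespace Literature.NumberTheory.LFunctions

namespace MaynardPratt

/-! ## An elementary inequality and the holomorphic extension of `h` -/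

/-- `yᵐ e^{-ay} ≤ (m/(ae))ᵐ` for `y ≥ 0`, `a > 0` (the maximum of `yᵐe^{-ay}` is at `y = m/a`;
proved from `1 + u ≤ eᵘ`). [folklore] -/
theorem pow_mul_exp_neg_mul_le {a y : ℝ} (ha : 0 < a) (hy : 0 ≤ y) (m : ℕ) :
    y ^ m * Real.exp (-(a * y)) ≤ (m / (a * Real.exp 1)) ^ m := by
  rcases Nat.eq_zero_or_pos m with rfl | hm
  · have : Real.exp (-(a * y)) ≤ 1 := Real.exp_le_one_iff.mpr (by nlinarith)
    simpa using this
  · have hm' : (0:ℝ) < m := by exact_mod_cast hm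
    set w := a * y / m with hw
    have hw0 : 0 ≤ w := by positivity
    have key : w * Real.exp (1 - w) ≤ 1 := by
      have h1 := Real.add_one_le_exp (w - 1)
      calc w * Real.exp (1 - w) ≤ Real.exp (w - 1) * Real.exp (1 - w) := by
            gcongr; linarith
        _ = 1 := by rw [← Real.exp_add]; norm_num
    have hyw : y = m / a * w := by
      rw [hw]; field_simp
    have hexp : Real.exp (-(a * y)) = Real.exp (1 - w) ^ m / Real.exp 1 ^ m := by
      rw [← Real.exp_nat_mul, ← Real.exp_nat_mul, ← Real.exp_sub]
      congr 1
      rw [hw]; field_simp; ring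
    calc y ^ m * Real.exp (-(a * y))
        = (m / (a * Real.exp 1)) ^ m * (w * Real.exp (1 - w)) ^ m := by
          rw [hexp, hyw, mul_pow, mul_pow, div_pow, div_pow, div_pow, mul_pow]
          ring
      _ ≤ (m / (a * Real.exp 1)) ^ m * 1 := by
          gcongr
          exact pow_le_one₀ (by positivity) key
      _ = _ := mul_one _

/-- On `(0, 1)` the function `h` of Lemma 43 (`MaynardPratt.w0Core`) is the restriction of the
holomorphic function `hℂ(z) = exp(−1/z) · exp(−1/(1−z))` (note `1/(z(1−z)) = 1/z + 1/(1−z)`).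
[cite: MaynardPratt2024, Lemma 43] -/
theorem hC_ofReal {x : ℝ} (h0 : 0 < x) (h1 : x < 1) :
    cexp (-(x : ℂ)⁻¹) * cexp (-(1 - (x : ℂ))⁻¹) = (w0Core x : ℂ) := by
  have h1' : 0 < 1 - x := sub_pos.2 h1
  simp only [w0Core, expNegInvGlue, not_le.2 h0, not_le.2 h1', if_false]
  push_cast
  ring_nf

/-- `hℂ(z) = exp(−1/z) exp(−1/(1−z))` is holomorphic off `{0, 1}`. [folklore] -/
theorem differentiableAt_hC {z : ℂ} (h0 : z ≠ 0) (h1 : z ≠ 1) :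
    DifferentiableAt ℂ (fun z : ℂ ↦ cexp (-z⁻¹) * cexp (-(1 - z)⁻¹)) z := by
  have h1' : 1 - z ≠ 0 := sub_ne_zero.2 (Ne.symm h1)
  fun_prop (disch := assumption)

/-- `|hℂ(z)| = exp(−Re z⁻¹) · exp(−Re (1−z)⁻¹)`. [folklore] -/
theorem norm_hC (z : ℂ) :
    ‖cexp (-z⁻¹) * cexp (-(1 - z)⁻¹)‖ = Real.exp (-(z⁻¹).re) * Real.exp (-((1 - z)⁻¹).re) := by
  rw [norm_mul, Complex.norm_exp, Complex.norm_exp, neg_re, neg_re]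

/-- On the circle `|z − x| = r` with `0 ≤ r < x` one has `Re(1/z) ≥ 1/(x + r)`: indeed
`(x + r) Re z − |z|² = (x − r)(r − Re(z − x)) ≥ 0`. This is what makes Cauchy's estimate for `hℂ` on
circles reaching towards the essential singularity at `0` effective. [folklore] -/
theorem inv_re_ge_of_norm_sub_eq {x r : ℝ} {z : ℂ} (hr : 0 ≤ r) (hrx : r < x) (hz : ‖z - x‖ = r) :
    1 / (x + r) ≤ (z⁻¹).re := by
  set w := z - x with hw
  have hzw : z = x + w := by rw [hw]; ring
  have hwre : w.re ≤ r := (Complex.re_le_norm w).trans hz.le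
  have hwre' : -r ≤ w.re := by
    have := Complex.abs_re_le_norm w
    rw [abs_le] at this
    linarith [this.1]
  have hwn : w.re ^ 2 + w.im ^ 2 = r ^ 2 := by
    rw [← hz, Complex.sq_norm, Complex.normSq_apply]; ring
  have hzre : z.re = x + w.re := by rw [hzw]; simp
  have hzim : z.im = w.im := by rw [hzw]; simp
  have hnormsq : Complex.normSq z = (x + w.re) ^ 2 + w.im ^ 2 := by
    rw [Complex.normSq_apply, hzre, hzim]; ring
  have hzpos : 0 < Complex.normSq z := by
    rw [hnormsq]; nlinarith
  rw [Complex.inv_re, hzre, div_le_div_iff₀ (by linarith) hzpos, one_mul, hnormsq]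
  nlinarith [mul_nonneg (sub_nonneg.2 hwre) (sub_nonneg.2 hrx.le)]

/-- On the circle `|z − x| = r` (`r < x`, `r < 1 − x`):
`|hℂ(z)| ≤ exp(−1/(x+r)) · exp(−1/(1−x+r))`. [folklore] -/
theorem norm_hC_le_of_mem_sphere {x r : ℝ} (hr : 0 ≤ r) (hrx : r < x) (hrx' : r < 1 - x) {z : ℂ}
    (hz : z ∈ sphere (x : ℂ) r) :
    ‖cexp (-z⁻¹) * cexp (-(1 - z)⁻¹)‖ ≤
      Real.exp (-(1 / (x + r))) * Real.exp (-(1 / (1 - x + r))) := by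
  rw [mem_sphere_iff_norm] at hz
  have h1 := inv_re_ge_of_norm_sub_eq hr hrx hz
  have hz' : ‖(1 - z) - ((1 - x : ℝ) : ℂ)‖ = r := by
    rw [← hz, ← norm_neg]; congr 1; push_cast; ring
  have h2 := inv_re_ge_of_norm_sub_eq hr hrx' hz'
  rw [norm_hC]
  gcongr ?_ * ?_
  · simpa using h1
  · simpa using h2

/-- **Cauchy's estimate for `hℂ`** on the circle `|z − x| = r` (`0 < r < min(x, 1−x)`):
`|hℂ^{(m)}(x)| ≤ m! · exp(−1/(x+r)) exp(−1/(1−x+r)) / rᵐ`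
(Mathlib's `Complex.norm_iteratedDeriv_le_of_forall_mem_sphere_norm_le`). [folklore] -/
theorem norm_iteratedDeriv_hC_le {x r : ℝ} (hr : 0 < r) (hrx : r < x) (hrx' : r < 1 - x) (m : ℕ) :
    ‖iteratedDeriv m (fun z : ℂ ↦ cexp (-z⁻¹) * cexp (-(1 - z)⁻¹)) x‖ ≤
      m ! * (Real.exp (-(1 / (x + r))) * Real.exp (-(1 / (1 - x + r)))) / r ^ m := by
  refine Complex.norm_iteratedDeriv_le_of_forall_mem_sphere_norm_le m hr ?_
    fun z hz ↦ norm_hC_le_of_mem_sphere hr.le hrx hrx' hz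
  refine DifferentiableOn.diffContOnCl fun z hz ↦ ?_
  rw [closure_ball _ hr.ne', mem_closedBall_iff_norm] at hz
  have hre : |z.re - x| ≤ r := by
    have := Complex.abs_re_le_norm (z - x)
    simpa using this.trans hz
  rw [abs_le] at hre
  refine (differentiableAt_hC ?_ ?_).differentiableWithinAt
  · intro h; rw [h] at hre; simp at hre; linarith [hre.1]
  · intro h; rw [h] at hre; simp at hre; linarith [hre.2]

/-- The iterated derivatives of a function holomorphic on an open set are holomorphic there.
[folklore] -/
theorem differentiableOn_iteratedDeriv_of_isOpen {e : ℂ → ℂ} {V : Set ℂ} (hV : IsOpen V)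
    (he : DifferentiableOn ℂ e V) (m : ℕ) : DifferentiableOn ℂ (iteratedDeriv m e) V := by
  induction m with
  | zero => simpa using he
  | succ m ih => rw [iteratedDeriv_succ]; exact ih.deriv hV

/-- **Restriction to the real axis commutes with iterated derivatives**: for `e` holomorphic on an
open `V ⊆ ℂ` and a real `x ∈ V`, the `m`-th derivative of the real-variable function `y ↦ e(y)` at
`x` is `e^{(m)}(x)`. [folklore] -/
theorem iteratedDeriv_comp_ofReal_eq {e : ℂ → ℂ} {V : Set ℂ} (hV : IsOpen V)
    (he : DifferentiableOn ℂ e V) (m : ℕ) {x : ℝ} (hx : (x : ℂ) ∈ V) :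
    iteratedDeriv m (fun y : ℝ ↦ e y) x = iteratedDeriv m e x := by
  induction m generalizing x with
  | zero => simp
  | succ m ih =>
    have hdiff := differentiableOn_iteratedDeriv_of_isOpen hV he m
    rw [iteratedDeriv_succ, iteratedDeriv_succ]
    have hev : (iteratedDeriv m fun y : ℝ ↦ e y) =ᶠ[𝓝 x] fun y : ℝ ↦ iteratedDeriv m e y := by
      have : ∀ᶠ y : ℝ in 𝓝 x, (y : ℂ) ∈ V :=
        Complex.continuous_ofReal.continuousAt.preimage_mem_nhds (hV.mem_nhds hx)
      filter_upwards [this] with y hy using ih hy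
    rw [hev.deriv_eq]
    have h2 : HasDerivAt (iteratedDeriv m e) (deriv (iteratedDeriv m e) x) x :=
      ((hdiff _ hx).differentiableAt (hV.mem_nhds hx)).hasDerivAt
    exact h2.comp_ofReal.deriv

/-- Complexification commutes with iterated derivatives of smooth real functions (same statement
as `Literature.Barriers.Parity.…iteratedDeriv_ofReal_comp`, reproved here to keep the import closure
small). [folklore] -/
theorem iteratedDeriv_ofReal_comp {g : ℝ → ℝ} (hg : ContDiff ℝ (⊤ : ℕ∞) g) (n : ℕ) :
    iteratedDeriv n (fun x ↦ (g x : ℂ)) = fun x ↦ ((iteratedDeriv n g x : ℝ) : ℂ) := by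
  induction n with
  | zero => simp [iteratedDeriv_zero]
  | succ n ih =>
    rw [iteratedDeriv_succ, ih, iteratedDeriv_succ]
    ext x
    have hd : Differentiable ℝ (iteratedDeriv n g) :=
      hg.differentiable_iteratedDeriv n (by exact_mod_cast ENat.coe_lt_top n)
    exact ((hd x).hasDerivAt.ofReal_comp).deriv

/-- `ℂ ∖ {0, 1}` is open. [folklore] -/
theorem isOpen_hCDomain : IsOpen {z : ℂ | z ≠ 0 ∧ z ≠ 1} :=
  isOpen_ne.inter isOpen_ne

/-- `hℂ` is holomorphic on `ℂ ∖ {0, 1}`. [folklore] -/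
theorem differentiableOn_hC :
    DifferentiableOn ℂ (fun z : ℂ ↦ cexp (-z⁻¹) * cexp (-(1 - z)⁻¹)) {z : ℂ | z ≠ 0 ∧ z ≠ 1} :=
  fun _ hz ↦ (differentiableAt_hC hz.1 hz.2).differentiableWithinAt

/-- For `0 < x < 1` the real iterated derivatives of `h` are the complex ones of `hℂ`:
`h^{(m)}(x) = hℂ^{(m)}(x)`. [folklore] -/
theorem iteratedDeriv_w0Core_eq_hC {x : ℝ} (h0 : 0 < x) (h1 : x < 1) (m : ℕ) :
    ((iteratedDeriv m w0Core x : ℝ) : ℂ) =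
      iteratedDeriv m (fun z : ℂ ↦ cexp (-z⁻¹) * cexp (-(1 - z)⁻¹)) x := by
  have hx : (x : ℂ) ∈ {z : ℂ | z ≠ 0 ∧ z ≠ 1} := by
    constructor
    · exact_mod_cast h0.ne'
    · exact_mod_cast h1.ne
  rw [← iteratedDeriv_comp_ofReal_eq isOpen_hCDomain differentiableOn_hC m hx]
  have h2 := congrFun (iteratedDeriv_ofReal_comp (contDiff_w0Core (n := ⊤)) m) x
  rw [← h2]
  refine Filter.EventuallyEq.iteratedDeriv_eq m ?_
  have hmem : Ioo (0 : ℝ) 1 ∈ 𝓝 x := Ioo_mem_nhds h0 h1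
  filter_upwards [hmem] with y hy
  exact (hC_ofReal hy.1 hy.2).symm

/-- A continuous function vanishing on `(−∞, a)` vanishes at `a`. [folklore] -/
theorem eq_zero_of_eqOn_Iio {g : ℝ → ℝ} (hg : Continuous g) {a : ℝ} (h : ∀ x < a, g x = 0) :
    g a = 0 := by
  have hcl : IsClosed {x | g x = 0} := isClosed_eq hg continuous_const
  have hsub : Iio a ⊆ {x | g x = 0} := fun x hx ↦ h x hx
  have := closure_minimal hsub hcl
  rw [closure_Iio] at this
  exact this self_mem_Iic

/-- A continuous function vanishing on `(a, ∞)` vanishes at `a`. [folklore] -/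
theorem eq_zero_of_eqOn_Ioi {g : ℝ → ℝ} (hg : Continuous g) {a : ℝ} (h : ∀ x, a < x → g x = 0) :
    g a = 0 := by
  have hcl : IsClosed {x | g x = 0} := isClosed_eq hg continuous_const
  have hsub : Ioi a ⊆ {x | g x = 0} := fun x hx ↦ h x hx
  have := closure_minimal hsub hcl
  rw [closure_Ioi] at this
  exact this self_mem_Ici

/-- All derivatives of `h` vanish on `(−∞, 0]` (`h` is flat at `0`). [cite: MaynardPratt2024, Lemma 43] -/
theorem iteratedDeriv_w0Core_of_nonpos (m : ℕ) {x : ℝ} (hx : x ≤ 0) :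
    iteratedDeriv m w0Core x = 0 := by
  have hopen : ∀ y < (0 : ℝ), iteratedDeriv m w0Core y = 0 := by
    intro y hy
    have : w0Core =ᶠ[𝓝 y] fun _ ↦ (0 : ℝ) := by
      filter_upwards [Iio_mem_nhds hy] with u hu using w0Core_of_nonpos hu.le
    rw [this.iteratedDeriv_eq, iteratedDeriv_const]
    split_ifs <;> rfl
  rcases hx.lt_or_eq with hx | rfl
  · exact hopen x hx
  · exact eq_zero_of_eqOn_Iio
      (contDiff_w0Core.continuous_iteratedDeriv m (by exact_mod_cast le_top)) hopen

/-- All derivatives of `h` vanish on `[1, ∞)` (`h` is flat at `1`). [cite: MaynardPratt2024, Lemma 43] -/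
theorem iteratedDeriv_w0Core_of_one_le (m : ℕ) {x : ℝ} (hx : 1 ≤ x) :
    iteratedDeriv m w0Core x = 0 := by
  have hopen : ∀ y, (1 : ℝ) < y → iteratedDeriv m w0Core y = 0 := by
    intro y hy
    have : w0Core =ᶠ[𝓝 y] fun _ ↦ (0 : ℝ) := by
      filter_upwards [Ioi_mem_nhds hy] with u hu using w0Core_of_one_le hu.le
    rw [this.iteratedDeriv_eq, iteratedDeriv_const]
    split_ifs <;> rfl
  rcases hx.lt_or_eq with hx | rfl
  · exact hopen x hx
  · exact eq_zero_of_eqOn_Ioi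
      (contDiff_w0Core.continuous_iteratedDeriv m (by exact_mod_cast le_top)) hopen

/-- **Gevrey-2 bound for `h`** (the derivative estimate `sup |h^{(j)}| ≤ j!(2j/e)^j` quoted from
[Iwa2014] in the proof of Lemma 43, here with the constant `3` in place of `2`):
`|h^{(m)}(x)| ≤ m! (3m/e)ᵐ` for all real `x` and all `m`. Proof: Cauchy's estimate on the circle of
radius `x/2` (resp. `(1−x)/2`) about `x ∈ (0, 1/2]` (resp. `x ∈ [1/2, 1)`), where
`|hℂ| ≤ exp(−2/(3x))` (resp. `exp(−2/(3(1−x)))`), and `x^{-m} e^{−2/(3x)} ≤ (3m/(2e))ᵐ`.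
[cite: MaynardPratt2024, Lemma 43] -/
theorem norm_iteratedDeriv_w0Core_le (m : ℕ) (x : ℝ) :
    ‖iteratedDeriv m w0Core x‖ ≤ m ! * (3 * m / Real.exp 1) ^ m := by
  have hRHS : 0 ≤ (m ! : ℝ) * (3 * m / Real.exp 1) ^ m := by positivity
  by_cases h0 : x ≤ 0
  · rw [iteratedDeriv_w0Core_of_nonpos m h0, norm_zero]; exact hRHS
  by_cases h1 : 1 ≤ x
  · rw [iteratedDeriv_w0Core_of_one_le m h1, norm_zero]; exact hRHS
  push Not at h0 h1
  rw [show ‖iteratedDeriv m w0Core x‖ = ‖((iteratedDeriv m w0Core x : ℝ) : ℂ)‖ by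
    rw [Complex.norm_real], iteratedDeriv_w0Core_eq_hC h0 h1]
  -- the key estimate `u^{-m} e^{-2/(3u)} ≤ ...` for `u = x` or `u = 1 - x`
  have key : ∀ u : ℝ, 0 < u →
      (m ! : ℝ) * Real.exp (-(1 / (u + u / 2))) / (u / 2) ^ m ≤ m ! * (3 * m / Real.exp 1) ^ m := by
    intro u hu
    have h := pow_mul_exp_neg_mul_le (a := 2 / 3) (y := 1 / u) (by norm_num) (by positivity) m
    rw [mul_div_assoc]
    gcongr
    rw [div_le_iff₀ (by positivity)]
    calc Real.exp (-(1 / (u + u / 2))) = (1 / u) ^ m * Real.exp (-(2 / 3 * (1 / u))) * u ^ m := by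
          rw [show -(1 / (u + u / 2)) = -(2 / 3 * (1 / u)) by field_simp; norm_num]
          rw [mul_comm ((1 / u) ^ m), mul_assoc, ← mul_pow, one_div_mul_cancel hu.ne', one_pow,
            mul_one]
      _ ≤ (m / (2 / 3 * Real.exp 1)) ^ m * u ^ m := by gcongr
      _ = (3 * m / Real.exp 1) ^ m * (u / 2) ^ m := by
          rw [← mul_pow, ← mul_pow]; congr 1; field_simp
  rcases le_or_gt x (1 / 2) with hx | hx
  · -- circle of radius x/2
    have hb := norm_iteratedDeriv_hC_le (x := x) (r := x / 2) (by positivity) (by linarith)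
      (by linarith) m
    refine hb.trans (le_trans ?_ (key x h0))
    gcongr
    calc Real.exp (-(1 / (x + x / 2))) * Real.exp (-(1 / (1 - x + x / 2)))
        ≤ Real.exp (-(1 / (x + x / 2))) * 1 := by
          gcongr; rw [Real.exp_le_one_iff, neg_nonpos]; positivity
      _ = _ := mul_one _
  · -- circle of radius (1 - x)/2
    have h1' : 0 < 1 - x := by linarith
    have hb := norm_iteratedDeriv_hC_le (x := x) (r := (1 - x) / 2) (by positivity) (by linarith)
      (by linarith) m
    refine hb.trans (le_trans ?_ (key (1 - x) h1'))
    rw [show 1 - x + (1 - x) / 2 = (1 - x) + (1 - x) / 2 by ring]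
    gcongr
    calc Real.exp (-(1 / (x + (1 - x) / 2))) * Real.exp (-(1 / ((1 - x) + (1 - x) / 2)))
        ≤ 1 * Real.exp (-(1 / ((1 - x) + (1 - x) / 2))) := by
          gcongr; rw [Real.exp_le_one_iff, neg_nonpos]; positivity
      _ = _ := one_mul _

/-! ## Stirling-type conversion -/

/-- `n! ≤ e √n (n/e)ⁿ` for `n ≥ 1` (upper-bound form of Stirling's formula: Mathlib's
`Stirling.stirlingSeq` is decreasing from `stirlingSeq 1 = e/√2`). [folklore] -/
theorem factorial_le_exp_mul_sqrt_mul_pow {n : ℕ} (hn : 1 ≤ n) :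
    (n ! : ℝ) ≤ Real.exp 1 * √n * (n / Real.exp 1) ^ n := by
  obtain ⟨k, rfl⟩ : ∃ k, n = k + 1 := ⟨n - 1, by omega⟩
  have h1 : Stirling.stirlingSeq (k + 1) ≤ Stirling.stirlingSeq 1 := by
    have := Stirling.stirlingSeq'_antitone (Nat.zero_le k)
    simpa using this
  rw [Stirling.stirlingSeq_one, Stirling.stirlingSeq] at h1
  have hpos : 0 < √(2 * ((k + 1 : ℕ) : ℝ)) * (((k + 1 : ℕ) : ℝ) / Real.exp 1) ^ (k + 1) := by
    positivity
  rw [div_le_iff₀ hpos] at h1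
  refine h1.trans (le_of_eq ?_)
  rw [show (2 : ℝ) * ((k + 1 : ℕ) : ℝ) = 2 * ((k + 1 : ℕ) : ℝ) from rfl, Real.sqrt_mul (by norm_num)]
  field_simp

/-- The Gevrey bound in pure power form, as used for the Mellin decay:
`2^{k+1} · k!(3k/e)ᵏ ≤ (e³/3) · (6(k+1)²/e²)^{k+1}` (cf. the printed
`|w₀^{(j)}| ≤ C⁻¹ (4j²/e²)^j`, Lemma 43). [cite: MaynardPratt2024, Lemma 43] -/
theorem two_pow_mul_gevrey_le (k : ℕ) :
    (2 : ℝ) ^ (k + 1) * (k ! * (3 * k / Real.exp 1) ^ k) ≤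
      Real.exp 1 ^ 3 / 3 * (6 * ((k : ℝ) + 1) ^ 2 / Real.exp 1 ^ 2) ^ (k + 1) := by
  have he : 0 < Real.exp 1 := Real.exp_pos 1
  rcases Nat.eq_zero_or_pos k with rfl | hk
  · have h1 : (2 : ℝ) ^ (0 + 1) * ((0 : ℕ) ! * (3 * ((0 : ℕ) : ℝ) / Real.exp 1) ^ 0) = 2 := by
      norm_num
    have h2 : Real.exp 1 ^ 3 / 3 * (6 * (((0 : ℕ) : ℝ) + 1) ^ 2 / Real.exp 1 ^ 2) ^ (0 + 1) =
        2 * Real.exp 1 := by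
      simp only [Nat.cast_zero, zero_add, one_pow, mul_one, pow_one]
      field_simp
      ring
    rw [h1, h2]
    linarith [Real.add_one_le_exp (1 : ℝ)]
  have hk1 : (1 : ℝ) ≤ k := by exact_mod_cast hk
  have hst := factorial_le_exp_mul_sqrt_mul_pow hk
  -- k! (3k/e)^k ≤ e √k (3k²/e²)^k
  have h1 : (k ! : ℝ) * (3 * k / Real.exp 1) ^ k ≤
      Real.exp 1 * √k * (3 * (k : ℝ) ^ 2 / Real.exp 1 ^ 2) ^ k := by
    calc (k ! : ℝ) * (3 * k / Real.exp 1) ^ k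
        ≤ Real.exp 1 * √k * (k / Real.exp 1) ^ k * (3 * k / Real.exp 1) ^ k := by gcongr
      _ = Real.exp 1 * √k * (3 * (k : ℝ) ^ 2 / Real.exp 1 ^ 2) ^ k := by
          rw [mul_assoc, ← mul_pow]; congr 2; field_simp
  -- √k ≤ (k+1)^2 and 3k² ≤ 3(k+1)²
  have hsqrt : √(k : ℝ) ≤ ((k : ℝ) + 1) ^ 2 := by
    rw [Real.sqrt_le_left (by positivity)]
    nlinarith
  set E := Real.exp 1 with hE
  set K : ℝ := (k : ℝ) + 1 with hK
  have hpow : (6 * K ^ 2 / E ^ 2) ^ (k + 1) =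
      2 ^ (k + 1) * (3 * K ^ 2 / E ^ 2) ^ k * (3 * K ^ 2 / E ^ 2) := by
    rw [pow_succ, show 6 * K ^ 2 / E ^ 2 = 2 * (3 * K ^ 2 / E ^ 2) by ring, mul_pow]; ring
  calc (2 : ℝ) ^ (k + 1) * (k ! * (3 * k / E) ^ k)
      ≤ 2 ^ (k + 1) * (E * √k * (3 * (k : ℝ) ^ 2 / E ^ 2) ^ k) := by gcongr
    _ ≤ 2 ^ (k + 1) * (E * K ^ 2 * (3 * K ^ 2 / E ^ 2) ^ k) := by
          gcongr
          rw [hK]; linarith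
    _ = E ^ 3 / 3 * (6 * K ^ 2 / E ^ 2) ^ (k + 1) := by
          rw [hpow]
          field_simp

/-! ## The derivatives of `w₀` -/

/-- `H^{(k+1)} = h^{(k)}/C` (`H' = h/C`). [cite: MaynardPratt2024, Lemma 43] -/
theorem iteratedDeriv_succ_w0Step (k : ℕ) :
    iteratedDeriv (k + 1) w0Step = fun y ↦ iteratedDeriv k w0Core y / w0Const := by
  rw [iteratedDeriv_succ', deriv_w0Step]
  ext y
  exact iteratedDeriv_div_const _ _

/-- The derivatives of `w₀` (proof of Lemma 43, p. 25):
`w₀^{(k+1)}(x) = 2^{k+1} h^{(k)}(2x−1)/C − h^{(k)}(x−1)/C`. [cite: MaynardPratt2024, Lemma 43] -/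
theorem iteratedDeriv_succ_w0 (k : ℕ) (x : ℝ) :
    iteratedDeriv (k + 1) w0 x =
      2 ^ (k + 1) * (iteratedDeriv k w0Core (2 * x - 1) / w0Const) -
        iteratedDeriv k w0Core (x - 1) / w0Const := by
  have hw0 : w0 = (fun x ↦ w0Step (2 * x - 1)) - fun x ↦ w0Step (x - 1) := by
    ext x; rfl
  have hs : ContDiff ℝ ((k + 1 : ℕ) : ℕ∞) w0Step := contDiff_w0Step
  have h1 : ContDiff ℝ ((k + 1 : ℕ) : ℕ∞) (fun x : ℝ ↦ w0Step (2 * x - 1)) :=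
    hs.comp (by fun_prop)
  have h2 : ContDiff ℝ ((k + 1 : ℕ) : ℕ∞) (fun x : ℝ ↦ w0Step (x - 1)) :=
    hs.comp (by fun_prop)
  rw [hw0, iteratedDeriv_sub h1.contDiffAt h2.contDiffAt]
  have e2 : iteratedDeriv (k + 1) (fun x : ℝ ↦ w0Step (x - 1)) x =
      iteratedDeriv k w0Core (x - 1) / w0Const := by
    rw [iteratedDeriv_comp_sub_const, iteratedDeriv_succ_w0Step]
  have e1 : iteratedDeriv (k + 1) (fun x : ℝ ↦ w0Step (2 * x - 1)) x =
      2 ^ (k + 1) * (iteratedDeriv k w0Core (2 * x - 1) / w0Const) := by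
    have hg : ContDiff ℝ ((k + 1 : ℕ) : ℕ∞) (fun y : ℝ ↦ w0Step (y - 1)) := hs.comp (by fun_prop)
    have := congrFun (iteratedDeriv_comp_const_mul (n := k + 1)
      (f := fun y : ℝ ↦ w0Step (y - 1)) (by exact_mod_cast hg) 2) x
    rw [this, iteratedDeriv_comp_sub_const, iteratedDeriv_succ_w0Step]
  rw [e1, e2]

/-- For `x ≤ 1`: `w₀^{(k+1)}(x) = 2^{k+1} h^{(k)}(2x−1)/C` (the printed case `1/2 ≤ x ≤ 1`).
[cite: MaynardPratt2024, Lemma 43] -/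
theorem iteratedDeriv_succ_w0_of_le_one (k : ℕ) {x : ℝ} (hx : x ≤ 1) :
    iteratedDeriv (k + 1) w0 x = 2 ^ (k + 1) * (iteratedDeriv k w0Core (2 * x - 1) / w0Const) := by
  rw [iteratedDeriv_succ_w0, iteratedDeriv_w0Core_of_nonpos k (x := x - 1) (by linarith), zero_div,
    sub_zero]

/-- For `x ≥ 1`: `w₀^{(k+1)}(x) = −h^{(k)}(x−1)/C` (the printed case `1 ≤ x ≤ 2`).
[cite: MaynardPratt2024, Lemma 43] -/
theorem iteratedDeriv_succ_w0_of_one_le (k : ℕ) {x : ℝ} (hx : 1 ≤ x) :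
    iteratedDeriv (k + 1) w0 x = -(iteratedDeriv k w0Core (x - 1) / w0Const) := by
  rw [iteratedDeriv_succ_w0, iteratedDeriv_w0Core_of_one_le k (x := 2 * x - 1) (by linarith),
    zero_div, mul_zero, zero_sub]

/-- `w₀^{(k+1)}` vanishes on `(−∞, 1/2]`. [cite: MaynardPratt2024, Lemma 43] -/
theorem iteratedDeriv_succ_w0_of_le_half (k : ℕ) {x : ℝ} (hx : x ≤ 1 / 2) :
    iteratedDeriv (k + 1) w0 x = 0 := by
  rw [iteratedDeriv_succ_w0_of_le_one k (by linarith), iteratedDeriv_w0Core_of_nonpos k (by linarith)]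
  simp

/-- `w₀^{(k+1)}` vanishes on `[2, ∞)`. [cite: MaynardPratt2024, Lemma 43] -/
theorem iteratedDeriv_succ_w0_of_two_le (k : ℕ) {x : ℝ} (hx : 2 ≤ x) :
    iteratedDeriv (k + 1) w0 x = 0 := by
  rw [iteratedDeriv_succ_w0_of_one_le k (by linarith), iteratedDeriv_w0Core_of_one_le k (by linarith)]
  simp

/-- `w₀^{(k)}` is continuous. [cite: MaynardPratt2024, Lemma 43] -/
theorem continuous_iteratedDeriv_w0 (k : ℕ) : Continuous (iteratedDeriv k w0) :=
  contDiff_w0.continuous_iteratedDeriv k (by exact_mod_cast le_top)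

/-- Sup bound left of `1`: `|w₀^{(k+1)}(x)| ≤ 2^{k+1} k!(3k/e)ᵏ / C` for `x ≤ 1`.
[cite: MaynardPratt2024, Lemma 43] -/
theorem norm_iteratedDeriv_succ_w0_le_of_le_one (k : ℕ) {x : ℝ} (hx : x ≤ 1) :
    ‖iteratedDeriv (k + 1) w0 x‖ ≤ 2 ^ (k + 1) * (k ! * (3 * k / Real.exp 1) ^ k) / w0Const := by
  rw [iteratedDeriv_succ_w0_of_le_one k hx]
  calc ‖(2 : ℝ) ^ (k + 1) * (iteratedDeriv k w0Core (2 * x - 1) / w0Const)‖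
      = 2 ^ (k + 1) * (‖iteratedDeriv k w0Core (2 * x - 1)‖ / w0Const) := by
        rw [norm_mul, norm_div, norm_pow, Real.norm_ofNat, Real.norm_of_nonneg w0Const_pos.le]
    _ ≤ 2 ^ (k + 1) * ((k ! * (3 * k / Real.exp 1) ^ k) / w0Const) := by
        gcongr
        · exact w0Const_pos.le
        · exact norm_iteratedDeriv_w0Core_le k _
    _ = _ := by ring

/-- Sup bound right of `1`: `|w₀^{(k+1)}(x)| ≤ k!(3k/e)ᵏ / C` for `x ≥ 1`.
[cite: MaynardPratt2024, Lemma 43] -/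
theorem norm_iteratedDeriv_succ_w0_le_of_one_le (k : ℕ) {x : ℝ} (hx : 1 ≤ x) :
    ‖iteratedDeriv (k + 1) w0 x‖ ≤ (k ! * (3 * k / Real.exp 1) ^ k) / w0Const := by
  rw [iteratedDeriv_succ_w0_of_one_le k hx, norm_neg, norm_div, Real.norm_of_nonneg w0Const_pos.le]
  exact div_le_div_of_nonneg_right (norm_iteratedDeriv_w0Core_le k _) w0Const_pos.le

/-- All derivatives of `w₀` vanish at `1/2`. [cite: MaynardPratt2024, Lemma 43] -/
theorem iteratedDeriv_w0_half (k : ℕ) : iteratedDeriv k w0 (1 / 2) = 0 := by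
  cases k with
  | zero => simpa using w0_of_le_half le_rfl
  | succ k => exact iteratedDeriv_succ_w0_of_le_half k le_rfl

/-- All derivatives of `w₀` vanish at `2`. [cite: MaynardPratt2024, Lemma 43] -/
theorem iteratedDeriv_w0_two (k : ℕ) : iteratedDeriv k w0 2 = 0 := by
  cases k with
  | zero => simpa using w0_of_two_le le_rfl
  | succ k => exact iteratedDeriv_succ_w0_of_two_le k le_rfl

end MaynardPratt

end Literature.NumberTheory.LFunctions
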